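import Literature.AnabelianGeometry.AbsoluteAnabelian.ArchimedeanReconstruction

/-!
# [AbsTopIII] Corollary 2.8 — sub-DAG statements (D-0068 statements-first) of the printed
# construction «Galois-theoretic Reconstruction of Aut-holomorphic Spaces» (kurims pp.63–64)

S. Mochizuki, *Topics in Absolute Anabelian Geometry III*, §2, Corollary 2.8, kurims manuscript
pp.63 l.1 – p.64 l.15 (lit key `paper:url-5493eb38cbb7`, read on the holder's own render)
[cite: MochizukiAbsTopIII2015, Corollary 2.8 pp.63–64].  The printed proof is one sentence: «The validity
of the algorithm asserted in Corollary 2.8 is immediate from the constructions that appear in the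
statement of this algorithm [together with the references quoted in these constructions]» (p.64
l.13–15).  This file types the WELL-DEFINEDNESS statements implicit in steps (a), (b) of that
construction, as intermediate `Prop` statements over the interface shim `NFCurveData` of
`ArchimedeanReconstruction.lean` (p408225, FROZEN; nothing there is edited or restated), and PROVES the
purely formal ones.  Sub-DAG table: `plan/L4/SUBDAG-AbsTopIII-Cor-28.md` (rows `Cor-28.*.rN`).

Rows typed here (holder abc-iut-w5-d140, WAVE-5):
* r6  `HasPolarFunctions` (enough NF-rational functions with a prescribed pole — Riemann–Roch on `X_k̄`,
  the implicit input behind «divisor of poles avoids `S`»), and the PROVED consequences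
  `IsCauchyWith.enlarge`, `cauchyEquiv_refl/symm`, `cauchyEquiv_trans_of_hasPolarFunctions`
  («equivalent» is an equivalence relation — used silently when p.63 l.26 forms «the set of
  equivalence classes»);
* r7  the LIMIT reading of the sets `N(U,f)` (`Nlim`, `limitTopology`): membership of a class in the
  basic set decided by the limit of the values `f(x_j)` — recorded because the literal reading typed in
  p408225 (`∀ j, f(x_j) ∈ U`) makes the images closed-condition sets whose finite intersections isolate
  points (finding F-w5d140-2, kernel witness `Cor28TopologyWitness.lean`, evidence only);
* r8  the comparison statements «`X^top = X_v(k_v)`» over an explicit comparison datum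
  (`AnalyticComparison`, TODO-merge abc-iut-L4-t1's Thm 1.9 `ArisesFrom` data);
* r11 `ChartsCover`, `ChartAutIndependent` (charts by NF-rational functions form a local structure on
  which `𝒜_X(U_X) := f_U⁻¹ ∘ Aut^hol(U_v) ∘ f_U` does not depend on the chart);
* r12 `ReconstructsAutHolOnCharts` — the uniqueness clause of Cor 2.3 (ii) read ON THE CHARTED OPENS
  (the node's `ReconstructsAutHol := ∃! A : AutHolStructure D.Xtop, …` quantifies over arbitrary
  assignments), PROVED from `ChartAutIndependent`.
No new named facts are asserted; every `def … : Prop` below is an intermediate statement of the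
printed construction, to be proved (or refuted) by discharge seats.  No side is taken on [IUTchIII]
Cor 3.12; typed ≠ proved.
-/

noncomputable section

namespace Literature.AnabelianGeometry.AbsoluteAnabelian

namespace ArchimedeanReconstruction

open _root_.Filter _root_.Topology _root_.Set _root_.TopologicalSpace

variable (D : NFCurveData)

/-! ### Row r6: enough functions; «equivalent» is an equivalence relation -/

/-- **Cor 2.8 (a), implicit input (row Cor-28.a.r6): ENOUGH NF-RATIONAL FUNCTIONS WITH A PRESCRIBED
POLE.**  For every finite set `S` of NF-points and every NF-point `t ∉ S` there is an NF-rational function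
whose divisor of poles avoids `S` and which has a pole at `t` (for the genuine data: Riemann–Roch on the
proper smooth curve `X_k̄`, poles concentrated at `t`).  This is what makes «`x_j ∉ S` for all but finitely
many `j`» propagate from a conductor `S` to any larger finite set, hence what makes «equivalent»
(p.63 l.19–23) transitive.  Intermediate statement; not asserted.
[cite: MochizukiAbsTopIII2015, Corollary 2.8 (a) p.63] -/
def NFCurveData.HasPolarFunctions : Prop :=
  ∀ (S : Finset D.Pt) (t : D.Pt), t ∉ S → ∃ f : D.Fn, D.PolesAvoid f S ∧ D.eval f t = none

variable {D}

/-- Shrinking the conductor preserves «poles avoid». [cite: MochizukiAbsTopIII2015, Corollary 2.8 (a) p.63] -/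
theorem NFCurveData.PolesAvoid.mono {f : D.Fn} {S T : Finset D.Pt} (h : D.PolesAvoid f T) (hST : S ⊆ T) :
    D.PolesAvoid f S :=
  fun x hx => h x (hST hx)

/-- **Conductor enlargement** (row r6, PROVED): a Cauchy sequence with conductor `S` is Cauchy with any
larger finite conductor `T ⊇ S` that it eventually avoids. [cite: MochizukiAbsTopIII2015, Corollary 2.8 (a) p.63] -/
theorem NFCurveData.IsCauchyWith.enlarge {x : ℕ → D.Pt} {S T : Finset D.Pt} (h : D.IsCauchyWith x S)
    (hST : S ⊆ T) (hT : ∀ᶠ j in atTop, x j ∉ T) : D.IsCauchyWith x T where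
  eventually_not_mem := hT
  eventually_finite f hf := h.eventually_finite f (hf.mono hST)
  cauchy f hf := h.cauchy f (hf.mono hST)

/-- Under `HasPolarFunctions`, a Cauchy sequence with conductor `S` eventually avoids every NF-point
outside `S` (row r6, PROVED: a function regular on `S` with a pole at `t` has eventually finite values
along the sequence). [cite: MochizukiAbsTopIII2015, Corollary 2.8 (a) p.63] -/
theorem NFCurveData.IsCauchyWith.eventually_ne (hP : D.HasPolarFunctions) {x : ℕ → D.Pt}
    {S : Finset D.Pt} (h : D.IsCauchyWith x S) {t : D.Pt} (ht : t ∉ S) : ∀ᶠ j in atTop, x j ≠ t := by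
  obtain ⟨f, hfS, hft⟩ := hP S t ht
  filter_upwards [h.eventually_finite f hfS] with j hj
  rintro rfl
  exact hj hft

/-- Under `HasPolarFunctions`, conductors may be enlarged freely (row r6, PROVED).
[cite: MochizukiAbsTopIII2015, Corollary 2.8 (a) p.63] -/
theorem NFCurveData.IsCauchyWith.union (hP : D.HasPolarFunctions) {x : ℕ → D.Pt} {S : Finset D.Pt}
    (h : D.IsCauchyWith x S) (T : Finset D.Pt) [DecidableEq D.Pt] : D.IsCauchyWith x (S ∪ T) := by
  refine h.enlarge Finset.subset_union_left ?_
  have hT : ∀ t ∈ T, ∀ᶠ j in atTop, x j ∈ S ∨ x j ≠ t := fun t _ => by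
    by_cases ht : t ∈ S
    · exact Eventually.of_forall fun j => by
        by_cases hj : x j = t
        · exact Or.inl (hj ▸ ht)
        · exact Or.inr hj
    · exact (h.eventually_ne hP ht).mono fun j hj => Or.inr hj
  have hall : ∀ᶠ j in atTop, ∀ t ∈ T, x j ∈ S ∨ x j ≠ t := (T.eventually_all).2 hT
  filter_upwards [hall, h.eventually_not_mem] with j hj hjS
  rw [Finset.mem_union, not_or]
  refine ⟨hjS, fun hjT => ?_⟩
  rcases hj (x j) hjT with h' | h'
  · exact hjS h'
  · exact h' rfl

/-- «Equivalent» is reflexive on Cauchy sequences (row r5/r6, PROVED: the values converge since `k_v` is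
complete). [cite: MochizukiAbsTopIII2015, Corollary 2.8 (a) p.63] -/
theorem NFCurveData.cauchyEquiv_refl {x : ℕ → D.Pt} (hx : D.IsCauchy x) : D.CauchyEquiv x x := by
  obtain ⟨S, hS⟩ := hx
  refine ⟨S, hS, hS, fun f hf => ?_⟩
  obtain ⟨a, ha⟩ := cauchySeq_tendsto_of_complete (hS.cauchy f hf)
  exact ⟨a, ha, ha⟩

/-- «Equivalent» is symmetric (row r5/r6, PROVED). [cite: MochizukiAbsTopIII2015, Corollary 2.8 (a) p.63] -/
theorem NFCurveData.cauchyEquiv_symm {x y : ℕ → D.Pt} (h : D.CauchyEquiv x y) : D.CauchyEquiv y x := by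
  obtain ⟨S, hx, hy, hS⟩ := h
  exact ⟨S, hy, hx, fun f hf => by obtain ⟨a, h₁, h₂⟩ := hS f hf; exact ⟨a, h₂, h₁⟩⟩

/-- **«Equivalent» is transitive** under `HasPolarFunctions` (row r6, PROVED): pass to the union of the
two conductors and use uniqueness of limits in `k_v`. [cite: MochizukiAbsTopIII2015, Corollary 2.8 (a) p.63] -/
theorem NFCurveData.cauchyEquiv_trans_of_hasPolarFunctions (hP : D.HasPolarFunctions) {x y z : ℕ → D.Pt}
    (hxy : D.CauchyEquiv x y) (hyz : D.CauchyEquiv y z) : D.CauchyEquiv x z := by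
  classical
  obtain ⟨S, hx, hy, hS⟩ := hxy
  obtain ⟨S', hy', hz, hS'⟩ := hyz
  refine ⟨S ∪ S', hx.union hP S', ?_, fun f hf => ?_⟩
  · have := hz.union hP S
    rwa [Finset.union_comm] at this
  · obtain ⟨a, hxa, hya⟩ := hS f (hf.mono Finset.subset_union_left)
    obtain ⟨b, hyb, hzb⟩ := hS' f (hf.mono Finset.subset_union_right)
    have hab : a = b := tendsto_nhds_unique hya hyb
    exact ⟨a, hxa, hab ▸ hzb⟩

variable (D) in
/-- **Row r6 (assembled):** under `HasPolarFunctions`, «equivalent» is an equivalence relation on the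
Cauchy sequences of NF-points — so «the set of equivalence classes» of p.63 l.26 is the quotient by this
relation itself (PROVED). [cite: MochizukiAbsTopIII2015, Corollary 2.8 (a) p.63] -/
theorem NFCurveData.cauchyEquiv_equivalence (hP : D.HasPolarFunctions) :
    Equivalence (fun x y : {x : ℕ → D.Pt // D.IsCauchy x} => D.CauchyEquiv x.1 y.1) where
  refl x := NFCurveData.cauchyEquiv_refl x.2
  symm h := NFCurveData.cauchyEquiv_symm h
  trans h₁ h₂ := NFCurveData.cauchyEquiv_trans_of_hasPolarFunctions hP h₁ h₂

/-! ### Row r7: the limit reading of the basic sets `N(U,f)` -/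

variable (D)

/-- **Cor 2.8 (a) (row Cor-28.a.r7), LIMIT READING of the basic sets**: the Cauchy sequences `{x_j}` whose
values `f(x_j)` are eventually finite and CONVERGE INTO `U` («such that `f(x_j)` [is finite and] `∈ U`»,
p.63 l.24–25, read at the limit — for the genuine data the image of this set in `X^top` is `f⁻¹(U)`).
Recorded alongside p408225's literal reading `NFCurveData.N` (whose images are closed-condition sets,
cf. the module docstring). Intermediate statement (definition); nothing asserted.
[cite: MochizukiAbsTopIII2015, Corollary 2.8 (a) p.63] -/
def NFCurveData.Nlim (U : Set D.kv) (f : D.Fn) : Set {x : ℕ → D.Pt // D.IsCauchy x} :=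
  {x | (∀ᶠ j in atTop, D.eval f (x.1 j) ≠ none) ∧
    ∃ a ∈ U, Tendsto (fun j => D.valv f (x.1 j)) atTop (𝓝 a)}

/-- **Cor 2.8 (a) (row r7), the topology «defined by the sets `N(U,f)`» in the limit reading**: generated
by the images in `X^top` of the `Nlim(U,f)`, `U ⊆ k_v` open.  A `def`, not an instance (the instance on
`D.Xtop` is p408225's literal reading). [cite: MochizukiAbsTopIII2015, Corollary 2.8 (a) p.63] -/
@[reducible] def NFCurveData.limitTopology : TopologicalSpace D.Xtop :=
  TopologicalSpace.generateFrom
    {W | ∃ (U : Set D.kv) (f : D.Fn), IsOpen U ∧ W = Quot.mk _ '' D.Nlim U f}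

/-! ### Row r8: «`X^top = X_v(k_v)`» — comparison statements -/

/-- **Comparison datum for row Cor-28.a.r8** (TODO-merge abc-iut-L4-t1, Thm 1.9 `ArisesFrom`): the
analytic space `X_v(k_v)` the construction is compared with — its points, the NF-points inside it, and
the values (or poles) of the NF-rational functions at its points, extending the values at NF-points.
Interface data only. [cite: MochizukiAbsTopIII2015, Corollary 2.8 (a) p.63] -/
structure NFCurveData.AnalyticComparison : Type 1 where
  /-- the topological space `X_v(k_v)` -/
  Xan : Type
  /-- its (analytic) topology -/
  top : TopologicalSpace Xan
  /-- the NF-points as points of `X_v(k_v)` -/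
  pt : D.Pt → Xan
  /-- the value of an NF-rational function at a point (`none` = pole) -/
  fval : D.Fn → Xan → Option D.kv
  /-- compatibility with the values at NF-points of Thm 1.9 (d) -/
  fval_pt : ∀ (f : D.Fn) (x : D.Pt), fval f (pt x) = (D.eval f x).map D.emb

variable {D}
variable (C : D.AnalyticComparison)

/-- **Row r8 (iii):** the NF-points are DENSE in `X_v(k_v)` (`v` archimedean: `X(k̄)` is dense in the
complex/real points). Intermediate statement. [cite: MochizukiAbsTopIII2015, Corollary 2.8 (a) p.63] -/
def NFCurveData.AnalyticComparison.DensePoints : Prop :=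
  @DenseRange C.Xan C.top D.Pt C.pt

/-- **Row r8 (i):** every Cauchy sequence of NF-points converges in `X_v(k_v)`.
Intermediate statement. [cite: MochizukiAbsTopIII2015, Corollary 2.8 (a) p.63] -/
def NFCurveData.AnalyticComparison.CauchyConverges : Prop :=
  ∀ x : ℕ → D.Pt, D.IsCauchy x → ∃ p : C.Xan, @Tendsto ℕ C.Xan (fun j => C.pt (x j)) atTop (@nhds C.Xan C.top p)

/-- **Row r8 (ii):** two Cauchy sequences of NF-points are «equivalent» iff they have the same limit in
`X_v(k_v)` (NF-rational functions separate points and are continuous off their poles).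
Intermediate statement. [cite: MochizukiAbsTopIII2015, Corollary 2.8 (a) p.63] -/
def NFCurveData.AnalyticComparison.EquivIffSameLimit : Prop :=
  ∀ (x y : ℕ → D.Pt) (p q : C.Xan), D.IsCauchy x → D.IsCauchy y →
    @Tendsto ℕ C.Xan (fun j => C.pt (x j)) atTop (@nhds C.Xan C.top p) →
    @Tendsto ℕ C.Xan (fun j => C.pt (y j)) atTop (@nhds C.Xan C.top q) →
      (D.CauchyEquiv x y ↔ p = q)

/-- **Row r8 (iii′):** every point of `X_v(k_v)` is the limit of a Cauchy sequence of NF-points (with a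
conductor containing the limit when the limit is itself an NF-point). Intermediate statement.
[cite: MochizukiAbsTopIII2015, Corollary 2.8 (a) p.63] -/
def NFCurveData.AnalyticComparison.PointsAreLimits : Prop :=
  ∀ p : C.Xan, ∃ x : ℕ → D.Pt, D.IsCauchy x ∧
    @Tendsto ℕ C.Xan (fun j => C.pt (x j)) atTop (@nhds C.Xan C.top p)

/-- **Row r8 (iv):** «`X^top = X_v(k_v)`» as TOPOLOGICAL SPACES: there is a bijection from the classes of
Cauchy sequences to `X_v(k_v)` sending a class to the limit of any representative, and it is a
homeomorphism for the limit-reading topology (the `f⁻¹(U)` form a sub-base of the analytic topology: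
NF-rational functions give local charts). Intermediate statement.
[cite: MochizukiAbsTopIII2015, Corollary 2.8 (a) p.63] -/
def NFCurveData.AnalyticComparison.TopologyAgrees : Prop :=
  ∃ e : D.Xtop ≃ C.Xan,
    (∀ x : {x : ℕ → D.Pt // D.IsCauchy x},
      @Tendsto ℕ C.Xan (fun j => C.pt (x.1 j)) atTop (@nhds C.Xan C.top (e (Quot.mk _ x)))) ∧
    @IsHomeomorph D.Xtop C.Xan D.limitTopology C.top e

/-! ### Rows r11, r12: charts form a local structure; the structure is pinned on charted opens -/

variable (D)

/-- **Cor 2.8 (b) (row Cor-28.b.r11), CHARTS COVER**: every point of `X^top` lies in a connected open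
`U_X` carrying a chart `f_U : U_X ⥲ U_v` onto a CONNECTED open `U_v ⊆ k_v` (print: «Let `U_X ⊆ X^top`,
`U_v ⊆ k_v` be connected open subsets and `f` … such that … `f_U : U_X ⥲ U_v`», p.63 l.29–33; for the
genuine data: an NF-rational function étale at the point is a local coordinate).  Stated over p408225's
`Chart` (hence over its topology on `X^top`). Intermediate statement.
[cite: MochizukiAbsTopIII2015, Corollary 2.8 (b) p.63] -/
def NFCurveData.ChartsCover : Prop :=
  ∀ p : D.Xtop, ∃ UX : Opens D.Xtop, p ∈ UX ∧ IsConnected (UX : Set D.Xtop) ∧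
    ∃ c : D.Chart UX, IsConnected (c.Uv : Set D.kv)

/-- **Cor 2.8 (b) (row Cor-28.b.r11), CHART INDEPENDENCE**: on a connected open `U_X` the group
`𝒜_X(U_X) := f_U⁻¹ ∘ Aut^hol(U_v) ∘ f_U` does not depend on the chart (for the genuine data: the transition
`f′_U ∘ f_U⁻¹` between two NF-rational charts is bi-analytic, so it conjugates `Aut^hol(U_v)` onto
`Aut^hol(U′_v)`).  This is what «the pre-Aut-holomorphic structure determined by the groups `𝒜_X(U_X)`»
(p.64 l.3–4) presupposes. Intermediate statement. [cite: MochizukiAbsTopIII2015, Corollary 2.8 (b) p.64] -/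
def NFCurveData.ChartAutIndependent : Prop :=
  ∀ (UX : Opens D.Xtop) (c c' : D.Chart UX),
    IsConnected (c.Uv : Set D.kv) → IsConnected (c'.Uv : Set D.kv) → c.aut = c'.aut

/-- **Cor 2.8 (b) (row Cor-28.b.r12), the assertion read ON THE CHARTED OPENS**: there is an
Aut-holomorphic structure on `X^top` agreeing with `f_U⁻¹ ∘ Aut^hol(U_v) ∘ f_U` on every charted connected
open, and any two such structures agree on every charted connected open (print: «the unique [cf.
Corollary 2.3, (ii)] Aut-holomorphic structure that extends the pre-Aut-holomorphic structure determined
by the groups `𝒜_X(U_X)`», p.64 l.2–4 — the uniqueness being Cor 2.3 (ii)'s, i.e. among Aut-holomorphic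
structures of Riemann surfaces, not among arbitrary assignments `U ↦ A(U)`; the node's
`ReconstructsAutHol` is the `∃!`-over-all-assignments reading). Intermediate statement.
[cite: MochizukiAbsTopIII2015, Corollary 2.8 (b) p.64] -/
def NFCurveData.ReconstructsAutHolOnCharts : Prop :=
  (∃ A : AutHolStructure D.Xtop, D.IsReconstructedStructure A) ∧
    ∀ A A' : AutHolStructure D.Xtop, D.IsReconstructedStructure A → D.IsReconstructedStructure A' →
      ∀ (UX : ConnectedOpens D.Xtop) (c : D.Chart UX.1), IsConnected (c.Uv : Set D.kv) →
        A.aut UX = A'.aut UX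

variable {D}

/-- The uniqueness half of `ReconstructsAutHolOnCharts` is formal (both structures equal `c.aut` there).
(bookkeeping, PROVED) [cite: MochizukiAbsTopIII2015, Corollary 2.8 (b) p.64] -/
theorem NFCurveData.aut_eq_of_isReconstructedStructure {A A' : AutHolStructure D.Xtop}
    (hA : D.IsReconstructedStructure A) (hA' : D.IsReconstructedStructure A')
    (UX : ConnectedOpens D.Xtop) (c : D.Chart UX.1) (hc : IsConnected (c.Uv : Set D.kv)) :
    A.aut UX = A'.aut UX := by
  rw [hA UX c hc, hA' UX c hc]

open Classical in
/-- The candidate structure: `c.aut` for some connected chart `c` where one exists, `⊤` elsewhere.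
(construction for the existence half) [cite: MochizukiAbsTopIII2015, Corollary 2.8 (b) p.64] -/
def NFCurveData.chartedStructure (D : NFCurveData) : AutHolStructure D.Xtop where
  aut UX :=
    if h : ∃ c : D.Chart UX.1, IsConnected (c.Uv : Set D.kv) then (Classical.choose h).aut else ⊤

/-- **Row r12 ⇐ row r11 (PROVED):** chart independence gives an Aut-holomorphic structure agreeing with
`f_U⁻¹ ∘ Aut^hol(U_v) ∘ f_U` on every charted connected open, hence `ReconstructsAutHolOnCharts`.
[cite: MochizukiAbsTopIII2015, Corollary 2.8 (b) p.64] -/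
theorem NFCurveData.reconstructsAutHolOnCharts_of_chartAutIndependent
    (h : D.ChartAutIndependent) : D.ReconstructsAutHolOnCharts := by
  classical
  refine ⟨⟨D.chartedStructure, fun UX c hc => ?_⟩,
    fun A A' hA hA' UX c hc => NFCurveData.aut_eq_of_isReconstructedStructure hA hA' UX c hc⟩
  have hex : ∃ c : D.Chart UX.1, IsConnected (c.Uv : Set D.kv) := ⟨c, hc⟩
  change (if h : ∃ c : D.Chart UX.1, IsConnected (c.Uv : Set D.kv) then (Classical.choose h).aut else ⊤)
    = c.aut
  rw [dif_pos hex]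
  exact h UX.1 _ c (Classical.choose_spec hex) hc

/-- The node's `∃!` reading implies the charted reading (PROVED; the converse is the content of rows
r8/r11 and fails for arbitrary assignments off the charted opens — cf. the module docstring).
[cite: MochizukiAbsTopIII2015, Corollary 2.8 (b) p.64] -/
theorem NFCurveData.reconstructsAutHolOnCharts_of_reconstructsAutHol (h : D.ReconstructsAutHol) :
    D.ReconstructsAutHolOnCharts :=
  ⟨h.exists, fun _ _ hA hA' UX c hc => NFCurveData.aut_eq_of_isReconstructedStructure hA hA' UX c hc⟩

/-! ### Rows r11/r12 in the limit reading (statements; combine repairs R1 and R2) -/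

variable (D)

/-- **Rows r11+r12 in the LIMIT READING (statement):** with `X^top` topologised by `limitTopology`, every
point has a connected open neighbourhood `U_X` and an NF-rational function `f` whose limit-values give a
homeomorphism of `U_X` onto a connected open `U_v ⊆ k_v`; this is the local structure `𝒰` of Def 2.1 (i)
on which the pre-Aut-holomorphic structure `U_X ↦ f_U⁻¹ ∘ Aut^hol(U_v) ∘ f_U` lives. Intermediate
statement over the limit reading; nothing asserted. [cite: MochizukiAbsTopIII2015, Corollary 2.8 (b) pp.63–64] -/
def NFCurveData.ChartsCoverLim : Prop :=
  letI : TopologicalSpace D.Xtop := D.limitTopology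
  ∀ p : D.Xtop, ∃ UX : Opens D.Xtop, p ∈ UX ∧ IsConnected (UX : Set D.Xtop) ∧
    ∃ (Uv : Opens D.kv) (f : D.Fn) (e : UX ≃ₜ Uv), IsConnected (Uv : Set D.kv) ∧
      ∀ (x : {x : ℕ → D.Pt // D.IsCauchy x}) (hx : Quot.mk _ x ∈ UX),
        Tendsto (fun j => D.valv f (x.1 j)) atTop (𝓝 ((e ⟨Quot.mk _ x, hx⟩ : Uv) : D.kv))

end ArchimedeanReconstruction

end Literature.AnabelianGeometry.AbsoluteAnabelian
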